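import Summits.CriticalPhenomena.PercolationContinuityZ3.Theorems.Transplant.AutChartQuasiTransitive
import Summits.CriticalPhenomena.PercolationContinuityZ3.Theorems.Transplant.FrmScaledTranslatingGroup
import Summits.CriticalPhenomena.PercolationContinuityZ3.Theorems.Transplant.SkelPhiPsiSteps
import HarnessLib

/-!
# Quasi-step rung (N3-b), LEVEL 0, row γ1 of WAVE-Q-MANIFEST v0.1: `p_c < 1` FROM FRAMES AND QUASI-STEPS ALONE — for every connected locally finite graph with a
# planar map `ψ : V → ℤ²` carrying translating frames with finitely many types (`Skelφ.Frames G ψ types`) and weak unit steps of any length (`Skelφ.PsiSteps G ψ M`),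
# `criticalProb G v < 1` at every vertex; no single-edge step, no Lipschitz bound, no cylinder (STEP-FREE replacement of `Skelφ.criticalProb_lt_one_of_steps`)

builds on p205010 (kernel theorem, internal audit signed; external expert review pending) — nothing in this file uses p205010; nothing here is a claim about any open node, and the
quasi-step carrier / node of N3B-RUNG.md are NOT declared here (planners' R2).  Lane `prim-bschramm`, seat `prim-bschramm-gen-1` (gen 4; GEN pen).  Helper file
(`--supports stmt-CriticalPhenomena-4575 --as helper`): φ-level, carrier-free, def-free.
WHY (WAVE-Q-MANIFEST §3 row γ1 / §4 item P1, HOME/WAVE-Q-MANIFEST.md; N3B-RUNG §4 (γ)).  In the used cone of the multi-type node p486426, `p_c < 1` enters through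
`Skelφ.criticalProb_lt_one_of_steps` («PlanarSkeletonCriticalProbLtOne»: the single-edge steps make the chart a weak covering of `ℤ²`, `p_c ≤ ½`).  A quasi-step chart is no weak
covering, so the quasi-step rung needs another source.  THIS FILE: the chart-translating automorphisms `A_ψ = {α ∣ ψ ∘ α − ψ const}` («FrmScaledTranslatingGroup»
`FrmScaledAut.exists_translatingSubgroup`) form a subgroup of `Aut(G)`; the frames lie in it, so `A_ψ` acts with FINITELY MANY ORBITS (the types cover); its translation character
`AutChart.chartHom` kills every stabiliser; and the quasi-steps give it RANK TWO — by `PsiSteps.exists_walk_eq` there are vertices `w_K` with `ψ w_K = ψ t + K eᵢ` for every `K : ℕ`, two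
of `w_0, …, w_{|types|}` share a type (pigeonhole), and the quotient of their frames translates `ψ` by a NON-ZERO multiple of `eᵢ`.  Hence p4-g25's step-free
`AutChart.criticalProb_lt_one_of_finite_orbits` («AutChartQuasiTransitive»: orbit Rips graph + Lyons–Peres Thm 7.15) applies:
**`Skelφ.criticalProb_lt_one_of_frames_psiSteps (hc) (hfr : Frames G ψ types) (hq : PsiSteps G ψ M) (v) : criticalProb G v < 1`.**
At `M = 1` (`psiSteps_of_steps`) this recovers `criticalProb_lt_one_of_steps` for framed charts (the regression rule of the manifest, §2); the customers' own route (p5-g27's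
`Z2Rot.rotor_criticalProb_lt_one`, p496890) is the same theorem with the group given explicitly.
* §1 `exists_translate_single_of_frames_psiSteps` (an `α ∈ A_ψ` translating by `k eᵢ`, `k ≠ 0`); §2 **`criticalProb_lt_one_of_frames_psiSteps`**.
[cite: BenjaminiSchramm1996, §2 Conj. 1; Thm. 1] [cite: LyonsPeres2016, §7.4 Thm. 7.15] [cite: KozmaNitzan2024, §4 p. 16 (Lemma 8)]
-/

noncomputable section

namespace Summit.CriticalPhenomena.PercolationContinuityZ3.Theorems.Transplant

namespace Skelφ

open SimpleGraph Literature.Barriers.CriticalPhenomena Literature.Probability.LatticeModels Literature.Probability.Percolation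
open scoped Classical

variable {V : Type} {G : SimpleGraph V} {ψ : V → Site 2} {types : Finset V} {M : ℕ}

/-! ## §1 A chart-translating automorphism moving the chart along each axis -/

/-- **Frames + quasi-steps give, for each axis, a chart-translating automorphism with a NON-ZERO translation along that axis** (pigeonhole on the types of the vertices
`w_K` with `ψ w_K = ψ t + K eᵢ`, `K = 0, …, |types|`). [cite: KozmaNitzan2024, §4 p. 16 (Lemma 8)] -/
theorem exists_translate_single_of_frames_psiSteps (hfr : Frames G ψ types) (hq : PsiSteps G ψ M) (t : V) (i : Fin 2) :
    ∃ (β : G ≃g G) (k : ℤ), k ≠ 0 ∧ ∀ x : V, ψ (β x) = ψ x + Pi.single i k := by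
  -- the vertices `w K`
  have hw : ∀ K : ℕ, ∃ w : V, ψ w = ψ t + Pi.single i (K : ℤ) := fun K => by
    obtain ⟨w', hw', -⟩ := hq.exists_walk_eq t (ψ t + Pi.single i (K : ℤ))
    exact ⟨w', hw'⟩
  choose w hw using hw
  -- their types and frames
  have htyp : ∀ K : ℕ, ∃ r ∈ types, ∃ α : G ≃g G, α r = w K ∧ ∀ x, ψ (α x) = ψ x + (ψ (w K) - ψ r) := fun K => hfr (w K)
  choose r hr α hαr hαx using htyp
  obtain ⟨K₁, -, K₂, -, hne, heq⟩ := Finset.exists_ne_map_eq_of_card_lt_of_maps_to (s := Finset.range (types.card + 1)) (t := types)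
    (by simp) (f := r) (fun K _ => hr K)
  -- `β := α K₂ ∘ (α K₁)⁻¹` translates by `(K₂ − K₁) eᵢ`
  refine ⟨(α K₁).symm.trans (α K₂), (K₂ : ℤ) - K₁, by omega, fun x => ?_⟩
  have h1 : ψ ((α K₁).symm x) = ψ x - (ψ (w K₁) - ψ (r K₁)) := by
    have := hαx K₁ ((α K₁).symm x)
    rw [RelIso.apply_symm_apply] at this
    rw [this]; abel
  rw [RelIso.trans_apply, hαx K₂, h1, hw K₁, hw K₂, heq, Pi.single_sub]
  abel

/-! ## §2 `p_c < 1` -/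

/-- **THEOREM (`p_c < 1` from frames and quasi-steps, step-free)**: a connected locally finite graph with a planar map `ψ` carrying translating frames with finitely many types
and weak unit steps of any length has `criticalProb G v < 1` at every vertex — the chart-translating automorphism group acts with finitely many orbits, its translation
character kills the stabilisers and has rank two (§1), so `AutChart.criticalProb_lt_one_of_finite_orbits` applies. [cite: BenjaminiSchramm1996, §2 Conj. 1; Thm. 1]
[cite: LyonsPeres2016, §7.4 Thm. 7.15] -/
theorem criticalProb_lt_one_of_frames_psiSteps [G.LocallyFinite] (hc : G.Connected) (hfr : Frames G ψ types) (hq : PsiSteps G ψ M) (v : V) :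
    criticalProb G v < 1 := by
  letI : MulAction (G ≃g G) V := AutChart.autMulAction G
  obtain ⟨A, hA⟩ := FrmScaledAut.exists_translatingSubgroup (G := G) ψ
  -- a base vertex `t` (the type of `v`)
  obtain ⟨t, -, -⟩ := hfr v
  have hact : IsActionByAut G A := fun a x y => (a : G ≃g G).map_rel_iff'
  -- the translation law on `A`, relative to `t`
  have hφ : ∀ (a : A) (x : V), ψ (a • x) = ψ x + (ψ (a • t) - ψ t) := by
    intro a x
    obtain ⟨d, hd⟩ := (hA a).1 a.2
    show ψ ((a : G ≃g G) x) = ψ x + (ψ ((a : G ≃g G) t) - ψ t)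
    rw [hd x, hd t, add_sub_cancel_left]
  -- the frames lie in `A`: the types are a covering transversal
  have hcover : ∀ x : V, ∃ a : A, ∃ r ∈ types, a • r = x := by
    intro x
    obtain ⟨r, hr, α, hαr, hαx⟩ := hfr x
    exact ⟨⟨α, (hA α).2 ⟨ψ x - ψ r, hαx⟩⟩, r, hr, hαr⟩
  -- the character kills the stabiliser of `t`
  have hstab : ∀ h ∈ MulAction.stabilizer A t, AutChart.chartHom t ψ hφ h = 1 := by
    intro h hh
    show Multiplicative.ofAdd (ψ (h • t) - ψ t) = 1
    rw [MulAction.mem_stabilizer_iff.1 hh, sub_self, ofAdd_zero]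
  -- rank two from §1
  have haxis : ∀ i : Fin 2, ∃ a : A, ∃ k : ℤ, k ≠ 0 ∧ Multiplicative.toAdd (AutChart.chartHom t ψ hφ a) = Pi.single i k := by
    intro i
    obtain ⟨β, k, hk, hβ⟩ := exists_translate_single_of_frames_psiSteps hfr hq t i
    refine ⟨⟨β, (hA β).2 ⟨Pi.single i k, hβ⟩⟩, k, hk, ?_⟩
    rw [AutChart.toAdd_chartHom]
    show ψ (β t) - ψ t = Pi.single i k
    rw [hβ t, add_sub_cancel_left]
  obtain ⟨a, k, hk, ha⟩ := haxis 0
  obtain ⟨b, l, hl, hb⟩ := haxis 1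
  have hrank : ∃ a b : A, MaxArea.det2 (Multiplicative.toAdd (AutChart.chartHom t ψ hφ a)) (Multiplicative.toAdd (AutChart.chartHom t ψ hφ b)) ≠ 0 :=
    ⟨a, b, by rw [ha, hb]; simp [MaxArea.det2, mul_ne_zero hk hl]⟩
  exact AutChart.criticalProb_lt_one_of_finite_orbits hact hc t types hcover (AutChart.chartHom t ψ hφ) hstab hrank v

end Skelφ

end Summit.CriticalPhenomena.PercolationContinuityZ3.Theorems.Transplant

end
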